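/-
Copyright (c) 2026 the pub-hodgecm-mathlib formalisation cell (harness21).  Prover seat hodgecm-mathlib-R90-C131-p04 (g3) on the S4 valve (dealer K2E2-plan (g8), S4-R80 FILE 3c;
pen R90-C131-p02 (g2)), road (J̃♭) (TJ6) «HERBRAND WINDOW»: THE FOUR WINDOW-SUBGROUP FAMILIES `K_W, cW, F_W, NW` — construction, membership letters, topology —
in the (TJ5-abs) frame of ★ `twistedTubeJacobian_of_local` ∕ ★ `herbrandWindow_of_index`.
Crux H413 `stmt-HodgeConjecture-24833`, lane `--supports … --as helper` (count-neutral).  THEOREMS ONLY (no `def`, no `instance`, no notation, no named-fact hypothesis, no `sorry`).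
-/
import Mathlib.Topology.Algebra.Group.OpenMapping
import Mathlib.Topology.Baire.LocallyCompactRegular
import Mathlib.Topology.Algebra.Group.ClosedSubgroup
import Mathlib.GroupTheory.Index
import HarnessLib

/-!
# R90-TF · S4 (Ch. 13.1–2) · road (J̃♭) (TJ6) «HERBRAND WINDOW», FILE 3c: the window subgroups `K_W = ker φ ∩ W`, `cW = c(W)`, `F_W = P′ ∩ W`, `NW = N(W)`

Cell `hodgecm-mathlib`, crux H413 (`stmt-HodgeConjecture-24833`, lane `--supports … --as helper`), route of record `HCCMUnconditional` (no route verbs;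
count-neutral).  Programme R90-TF, section S4 = [Rogawski1990] Ch. 13.1–13.2; the normalisation letter `h♮` of ★ `twistedTubeJacobian_of_local` ((TJ5-abs),
p864907) is paid by ★ `herbrandWindow_of_index` ((TJ6) FILE 3b, p865049) from the Herbrand index identity `[K_W : cW] = [F_W : NW]` ([Serre1979, Ch. VIII §4],
[Rogawski1990, §3.11 Prop. 3.11.1 pp. 34–35]) over FOUR FAMILIES OF WINDOW SUBGROUPS given by membership letters.  THIS FILE constructs the four families and
proves everything FILE 3b consumes EXCEPT the index identity `hidx` (FILE 3a, R90-C131-p02 (g2)).  Mathlib only; THEOREMS ONLY.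

FRAME (★ (TJ5-abs)): `ε : G →* G`, subgroups `P′ ≤ A ≤ G` with `A` abelian and `ε`-stable, `φ : ↥A →* P` with `φ ∘ ε = φ` on `A`, the pin `e : P ≃* ↥P′` with
`e(φ w) = w ε(w)`, windows `W : ℕ → Subgroup ↥A` (at the datum `A = T̃ = Cent_{G̃_v}(γ₀)`, `P′ = T′`, `φ = N`, `W j = T̃ ∩ c(Λ_j)` by ★ `exists_chartWindowSubgroups`).
* §1 **`exists_herbrandWindowData`** — THE FOUR FAMILIES with ★ FILE 3b's membership letters VERBATIM: `K_W j = ker φ ∩ W j` (`comap` along `ker φ ≤ A`),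
  `cW j = d(W j)` for the COBOUNDARY HOMOMORPHISM `d : ↥A →* ker φ`, `w ↦ w ε(w)⁻¹` (a homomorphism because `A` is abelian, into `ker φ` because `φ ∘ ε = φ`),
  `F_W j = P′ ∩ W j` (`comap` along `P′ ≤ A`), `NW j = (e ∘ φ)(W j)` (the norm `w ↦ w ε(w)` lands in `P′` BY THE PIN — no `ε ∘ ε = id` ∕ `P′ = A^ε` letter needed).
* §2 TOPOLOGY, for ANY families satisfying the four letters: `isOpen_KW`, `isCompact_KW`, `isOpen_FW`, `isCompact_FW`, `isCompact_cW`, **`isOpen_NW`** (UNCONDITIONAL: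
  `NW j = (e ∘ φ)(W j)` and a continuous surjective homomorphism from the σ-compact `↥A` onto the Baire group `↥P′` is open — Mathlib
  `MonoidHom.isOpenMap_of_sigmaCompact`; = FILE 3b's `hNWo` with `j₀ = 0`), `cW_le_KW`, and **`isOpen_cW_of_relIndex_ne_zero`** (`cW j`, a compact hence closed subgroup
  of finite index in the open `K_W j`, is open — Mathlib `Subgroup.isOpen_of_isClosed_of_finiteIndex`; = FILE 3b's `hcWo` once FILE 3a has `[K_W j : cW j] ≠ 0`).
HONEST LABEL: HC_CM is proved only modulo the 7 printed citations (2 remaining named inputs: hLiu418 = `stmt-HodgeConjecture-24832`, h413 =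
`stmt-HodgeConjecture-24833`) until rung 0 closes; this file closes no socket (REL ≠ ★ ≠ BUILT; count-neutral).

## References
* [Serre1979] J.-P. Serre, *Local Fields*, GTM 67 (1979), Ch. VIII §4 (Herbrand quotient of a cyclic group acting on a module). Context locator.
* [Rogawski1990] J. D. Rogawski, *Automorphic Representations of Unitary Groups in Three Variables*, Ann. of Math. Stud. 123 (1990), §3.11 Prop. 3.11.1 pp. 34–35;
  §12.5 p. 186. Context locator.
* [DeitmarEchterhoff2014] A. Deitmar, S. Echterhoff, *Principles of Harmonic Analysis*, 2nd ed. (2014), §1.5 (open mapping for σ-compact groups). Context locator.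
-/

set_option autoImplicit false
-- the mandated namespace repeats the single-problem summit's segment (`HodgeConjecture.HodgeConjecture`)
set_option linter.dupNamespace false

open Set Filter Topology Function
open scoped Pointwise

namespace Summit.HodgeConjecture.HodgeConjecture.R90.S4

section HerbrandWindowData

variable {G : Type*} [Group G] (ε : G →* G) (A P' : Subgroup G) {P : Type*} [Group P] (φ : ↥A →* P)

/-! ## §1 The four families -/

/-- **THE COBOUNDARY HOMOMORPHISM EXISTS**: on the abelian `ε`-stable `A` with `φ ∘ ε = φ`, `w ↦ w ε(w)⁻¹` is a homomorphism `↥A →* ker φ`.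
[cite: Serre1979, Ch. VIII §4] -/
theorem exists_coboundaryHom (hAc : ∀ x ∈ A, ∀ y ∈ A, x * y = y * x) (hεA : ∀ x ∈ A, ε x ∈ A) (hφε : ∀ w : ↥A, φ ⟨ε w, hεA w w.2⟩ = φ w) :
    ∃ d : ↥A →* ↥φ.ker, ∀ w : ↥A, ((d w : ↥A)) = w * (⟨ε w, hεA w w.2⟩ : ↥A)⁻¹ := by
  have hker : ∀ w : ↥A, w * (⟨ε w, hεA w w.2⟩ : ↥A)⁻¹ ∈ φ.ker := fun w => by
    rw [MonoidHom.mem_ker, map_mul, map_inv, hφε, mul_inv_cancel]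
  refine ⟨{ toFun := fun w => ⟨w * (⟨ε w, hεA w w.2⟩ : ↥A)⁻¹, hker w⟩
            map_one' := Subtype.ext (Subtype.ext (by simp))
            map_mul' := fun x y => Subtype.ext (Subtype.ext ?_) }, fun w => rfl⟩
  simp only [Subgroup.coe_mul, InvMemClass.coe_inv, map_mul, mul_inv_rev]
  -- `x y (εy)⁻¹ (εx)⁻¹ = x (εx)⁻¹ · y (εy)⁻¹` in the abelian `A`
  have h1 : (y : G) * ((ε y)⁻¹ * (ε x)⁻¹) = (y : G) * (ε y)⁻¹ * (ε x)⁻¹ := by rw [mul_assoc]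
  have hcomm : (ε x)⁻¹ * ((y : G) * (ε y)⁻¹) = (y : G) * (ε y)⁻¹ * (ε x)⁻¹ :=
    hAc _ (A.inv_mem (hεA x x.2)) _ (A.mul_mem y.2 (A.inv_mem (hεA y y.2)))
  calc (x : G) * (y : G) * ((ε y)⁻¹ * (ε x)⁻¹) = (x : G) * ((y : G) * (ε y)⁻¹ * (ε x)⁻¹) := by rw [mul_assoc, h1]
    _ = (x : G) * ((ε x)⁻¹ * ((y : G) * (ε y)⁻¹)) := by rw [hcomm]
    _ = (x : G) * (ε x)⁻¹ * ((y : G) * (ε y)⁻¹) := by rw [mul_assoc]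

/-- **THE FOUR WINDOW-SUBGROUP FAMILIES** (`exists_herbrandWindowData`): for windows `W j ≤ A` there are subgroups `K_W j, cW j ≤ ker φ` and `F_W j, NW j ≤ P′` with
★ `herbrandWindow_of_index`'s membership letters VERBATIM — `K_W j = ker φ ∩ W j`, `cW j = {w ε(w)⁻¹ | w ∈ W j}` (the coboundaries of the window), `F_W j = P′ ∩ W j`,
`NW j = {w ε(w) | w ∈ W j}` (the norms of the window, in `P′` through the pin `e(φ w) = w ε(w)`). [cite: Serre1979, Ch. VIII §4] [cite: Rogawski1990, §3.11 pp. 34–35] -/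
theorem exists_herbrandWindowData (hP'A : P' ≤ A) (hAc : ∀ x ∈ A, ∀ y ∈ A, x * y = y * x) (hεA : ∀ x ∈ A, ε x ∈ A)
    (hφε : ∀ w : ↥A, φ ⟨ε w, hεA w w.2⟩ = φ w) (e : P ≃* ↥P') (hφe : ∀ w : ↥A, ((e (φ w) : ↥P') : G) = (w : G) * ε w)
    (W : ℕ → Subgroup ↥A) :
    ∃ (KW cW : ℕ → Subgroup ↥φ.ker) (FW NW : ℕ → Subgroup ↥P'),
      (∀ (j : ℕ) (k : ↥φ.ker), k ∈ KW j ↔ (k : ↥A) ∈ W j) ∧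
      (∀ (j : ℕ) (k : ↥φ.ker), k ∈ cW j ↔ ∃ w ∈ W j, (((k : ↥A)) : G) = (w : G) * (ε w)⁻¹) ∧
      (∀ (j : ℕ) (p : ↥P'), p ∈ FW j ↔ (p : G) ∈ Subtype.val '' (W j : Set ↥A)) ∧
      (∀ (j : ℕ) (p : ↥P'), p ∈ NW j ↔ ∃ w ∈ W j, (p : G) = (w : G) * ε w) := by
  obtain ⟨d, hd⟩ := exists_coboundaryHom ε A φ hAc hεA hφε
  refine ⟨fun j => (W j).comap φ.ker.subtype, fun j => (W j).map d, fun j => (W j).comap (Subgroup.inclusion hP'A),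
    fun j => (W j).map ((e : P →* ↥P').comp φ), fun j k => Iff.rfl, fun j k => ?_, fun j p => ?_, fun j p => ?_⟩
  · -- `cW`
    rw [Subgroup.mem_map]
    constructor
    · rintro ⟨w, hw, hwk⟩
      refine ⟨w, hw, ?_⟩
      rw [← hwk, hd, Subgroup.coe_mul, InvMemClass.coe_inv]
    · rintro ⟨w, hw, hwk⟩
      refine ⟨w, hw, Subtype.ext (Subtype.ext ?_)⟩
      rw [hd, Subgroup.coe_mul, InvMemClass.coe_inv, ← hwk]
  · -- `FW`
    rw [Subgroup.mem_comap]
    constructor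
    · intro hp
      exact ⟨Subgroup.inclusion hP'A p, hp, rfl⟩
    · rintro ⟨w, hw, hwp⟩
      have : w = Subgroup.inclusion hP'A p := Subtype.ext hwp
      rwa [this] at hw
  · -- `NW`
    rw [Subgroup.mem_map]
    constructor
    · rintro ⟨w, hw, hwp⟩
      refine ⟨w, hw, ?_⟩
      rw [← hwp, MonoidHom.coe_comp, Function.comp_apply, MonoidHom.coe_coe, hφe]
    · rintro ⟨w, hw, hwp⟩
      refine ⟨w, hw, Subtype.ext ?_⟩
      rw [MonoidHom.coe_comp, Function.comp_apply, MonoidHom.coe_coe, hφe, ← hwp]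

/-- `cW j ≤ K_W j` for an `ε`-stable window (from the membership letters). [cite: Serre1979, Ch. VIII §4] -/
theorem cW_le_KW (hεA : ∀ x ∈ A, ε x ∈ A) (W : ℕ → Subgroup ↥A) (hWε : ∀ (j : ℕ) (w : ↥A), w ∈ W j → (⟨ε w, hεA w w.2⟩ : ↥A) ∈ W j)
    (KW cW : ℕ → Subgroup ↥φ.ker) (hKW : ∀ (j : ℕ) (k : ↥φ.ker), k ∈ KW j ↔ (k : ↥A) ∈ W j)
    (hcW : ∀ (j : ℕ) (k : ↥φ.ker), k ∈ cW j ↔ ∃ w ∈ W j, (((k : ↥A)) : G) = (w : G) * (ε w)⁻¹) (j : ℕ) : cW j ≤ KW j := by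
  intro k hk
  obtain ⟨w, hw, hwk⟩ := (hcW j k).1 hk
  rw [hKW]
  have : (k : ↥A) = w * (⟨ε w, hεA w w.2⟩ : ↥A)⁻¹ := Subtype.ext (by rw [hwk, Subgroup.coe_mul, InvMemClass.coe_inv])
  rw [this]
  exact (W j).mul_mem hw ((W j).inv_mem (hWε j w hw))

/-- `NW j ≤ F_W j` for an `ε`-stable window (from the membership letters). [cite: Serre1979, Ch. VIII §4] -/
theorem NW_le_FW (hεA : ∀ x ∈ A, ε x ∈ A) (W : ℕ → Subgroup ↥A)
    (hWε : ∀ (j : ℕ) (w : ↥A), w ∈ W j → (⟨ε w, hεA w w.2⟩ : ↥A) ∈ W j) (FW NW : ℕ → Subgroup ↥P')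
    (hFW : ∀ (j : ℕ) (p : ↥P'), p ∈ FW j ↔ (p : G) ∈ Subtype.val '' (W j : Set ↥A))
    (hNW : ∀ (j : ℕ) (p : ↥P'), p ∈ NW j ↔ ∃ w ∈ W j, (p : G) = (w : G) * ε w) (j : ℕ) : NW j ≤ FW j := by
  intro p hp
  obtain ⟨w, hw, hwp⟩ := (hNW j p).1 hp
  rw [hFW]
  refine ⟨w * ⟨ε w, hεA w w.2⟩, (W j).mul_mem hw (hWε j w hw), ?_⟩
  rw [Subgroup.coe_mul, ← hwp]

/-! ## §2 Topology of the four families -/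

variable [TopologicalSpace G] [IsTopologicalGroup G] [TopologicalSpace P]

omit [IsTopologicalGroup G] [TopologicalSpace P] in
/-- `K_W j` is open in `ker φ` when `W j` is open in `A`. [cite: DeitmarEchterhoff2014, §1.5] -/
theorem isOpen_KW (W : ℕ → Subgroup ↥A) (hWo : ∀ j, IsOpen (W j : Set ↥A)) (KW : ℕ → Subgroup ↥φ.ker)
    (hKW : ∀ (j : ℕ) (k : ↥φ.ker), k ∈ KW j ↔ (k : ↥A) ∈ W j) (j : ℕ) : IsOpen (KW j : Set ↥φ.ker) := by
  have h : (KW j : Set ↥φ.ker) = (Subtype.val : ↥φ.ker → ↥A) ⁻¹' (W j : Set ↥A) := Set.ext fun k => hKW j k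
  rw [h]
  exact (hWo j).preimage continuous_subtype_val

omit [IsTopologicalGroup G] in
/-- `K_W j` is compact when `W j` is compact and `φ` is continuous (`ker φ` is closed). [cite: DeitmarEchterhoff2014, §1.5] -/
theorem isCompact_KW [T1Space P] (hφc : Continuous φ) (W : ℕ → Subgroup ↥A) (hWc : ∀ j, IsCompact (W j : Set ↥A)) (KW : ℕ → Subgroup ↥φ.ker)
    (hKW : ∀ (j : ℕ) (k : ↥φ.ker), k ∈ KW j ↔ (k : ↥A) ∈ W j) (j : ℕ) : IsCompact (KW j : Set ↥φ.ker) := by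
  have hK : IsClosed ((φ.ker : Subgroup ↥A) : Set ↥A) := by
    have h : ((φ.ker : Subgroup ↥A) : Set ↥A) = φ ⁻¹' {1} := Set.ext fun a => by
      simp only [SetLike.mem_coe, MonoidHom.mem_ker, mem_preimage, mem_singleton_iff]
    rw [h]
    exact isClosed_singleton.preimage hφc
  have h : (KW j : Set ↥φ.ker) = (Subtype.val : ↥φ.ker → ↥A) ⁻¹' (W j : Set ↥A) := Set.ext fun k => hKW j k
  rw [h]
  exact hK.isClosedEmbedding_subtypeVal.isCompact_preimage (hWc j)

omit [IsTopologicalGroup G] [TopologicalSpace P] in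
/-- `F_W j` is open in `P′` when `W j` is open in `A` (`P′ ≤ A`). [cite: DeitmarEchterhoff2014, §1.5] -/
theorem isOpen_FW (hP'A : P' ≤ A) (W : ℕ → Subgroup ↥A) (hWo : ∀ j, IsOpen (W j : Set ↥A)) (FW : ℕ → Subgroup ↥P')
    (hFW : ∀ (j : ℕ) (p : ↥P'), p ∈ FW j ↔ (p : G) ∈ Subtype.val '' (W j : Set ↥A)) (j : ℕ) : IsOpen (FW j : Set ↥P') := by
  have h : (FW j : Set ↥P') = (fun p : ↥P' => (⟨(p : G), hP'A p.2⟩ : ↥A)) ⁻¹' (W j : Set ↥A) := by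
    ext p
    simp only [SetLike.mem_coe, hFW, mem_preimage, mem_image]
    constructor
    · rintro ⟨w, hw, hwp⟩
      have : w = ⟨(p : G), hP'A p.2⟩ := Subtype.ext hwp
      exact this ▸ hw
    · intro hp
      exact ⟨_, hp, rfl⟩
  rw [h]
  exact (hWo j).preimage (continuous_subtype_val.subtype_mk _)

omit [IsTopologicalGroup G] [TopologicalSpace P] in
/-- `F_W j` is compact when `W j` is compact and `P′` is closed. [cite: DeitmarEchterhoff2014, §1.5] -/
theorem isCompact_FW [hP' : IsClosed (P' : Set G)] (W : ℕ → Subgroup ↥A) (hWc : ∀ j, IsCompact (W j : Set ↥A)) (FW : ℕ → Subgroup ↥P')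
    (hFW : ∀ (j : ℕ) (p : ↥P'), p ∈ FW j ↔ (p : G) ∈ Subtype.val '' (W j : Set ↥A)) (j : ℕ) : IsCompact (FW j : Set ↥P') := by
  have h : (FW j : Set ↥P') = (Subtype.val : ↥P' → G) ⁻¹' (Subtype.val '' (W j : Set ↥A)) := Set.ext fun p => hFW j p
  rw [h]
  exact hP'.isClosedEmbedding_subtypeVal.isCompact_preimage ((hWc j).image continuous_subtype_val)

/-- `cW j` is compact (the continuous image of the compact window under `w ↦ w ε(w)⁻¹`). [cite: DeitmarEchterhoff2014, §1.5] -/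
theorem isCompact_cW [T1Space P] (hεA : ∀ x ∈ A, ε x ∈ A) (hεc : Continuous ε) (hφc : Continuous φ)
    (W : ℕ → Subgroup ↥A) (hWc : ∀ j, IsCompact (W j : Set ↥A)) (cW : ℕ → Subgroup ↥φ.ker)
    (hcW : ∀ (j : ℕ) (k : ↥φ.ker), k ∈ cW j ↔ ∃ w ∈ W j, (((k : ↥A)) : G) = (w : G) * (ε w)⁻¹) (j : ℕ) : IsCompact (cW j : Set ↥φ.ker) := by
  have hK : IsClosed ((φ.ker : Subgroup ↥A) : Set ↥A) := by
    have h : ((φ.ker : Subgroup ↥A) : Set ↥A) = φ ⁻¹' {1} := Set.ext fun a => by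
      simp only [SetLike.mem_coe, MonoidHom.mem_ker, mem_preimage, mem_singleton_iff]
    rw [h]
    exact isClosed_singleton.preimage hφc
  set cA : ↥A → ↥A := fun w => w * (⟨ε w, hεA w w.2⟩ : ↥A)⁻¹ with hcA
  have hcAc : Continuous cA := continuous_id.mul ((hεc.comp continuous_subtype_val).subtype_mk _).inv
  have h : (cW j : Set ↥φ.ker) = (Subtype.val : ↥φ.ker → ↥A) ⁻¹' (cA '' (W j : Set ↥A)) := by
    ext k
    simp only [SetLike.mem_coe, hcW, mem_preimage, mem_image, hcA]
    constructor
    · rintro ⟨w, hw, hwk⟩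
      exact ⟨w, hw, Subtype.ext (by rw [Subgroup.coe_mul, InvMemClass.coe_inv, ← hwk])⟩
    · rintro ⟨w, hw, hwk⟩
      exact ⟨w, hw, by rw [← hwk, Subgroup.coe_mul, InvMemClass.coe_inv]⟩
  rw [h]
  exact hK.isClosedEmbedding_subtypeVal.isCompact_preimage ((hWc j).image hcAc)

/-- **`NW j` IS OPEN** (= ★ FILE 3b's `hNWo`, with `j₀ = 0`): `NW j = (e ∘ φ)(W j)`, and the continuous surjective homomorphism `e ∘ φ` from the σ-compact `↥A`
onto the locally compact (Baire) group `↥P′` is an open map (Mathlib `MonoidHom.isOpenMap_of_sigmaCompact`). [cite: DeitmarEchterhoff2014, §1.5]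
[cite: Rogawski1990, §3.11 pp. 34–35] -/
theorem isOpen_NW [LocallyCompactSpace G] [SecondCountableTopology G] [T2Space G] [hA : IsClosed (A : Set G)] [hP' : IsClosed (P' : Set G)]
    (hφc : Continuous φ) (hφs : Function.Surjective φ) (e : P ≃* ↥P') (he : Continuous e)
    (hφe : ∀ w : ↥A, ((e (φ w) : ↥P') : G) = (w : G) * ε w)
    (W : ℕ → Subgroup ↥A) (hWo : ∀ j, IsOpen (W j : Set ↥A)) (NW : ℕ → Subgroup ↥P')
    (hNW : ∀ (j : ℕ) (p : ↥P'), p ∈ NW j ↔ ∃ w ∈ W j, (p : G) = (w : G) * ε w) (j : ℕ) : IsOpen (NW j : Set ↥P') := by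
  -- `NW j` is the image of `W j` under `e ∘ φ`
  have h : (NW j : Set ↥P') = ((e : P →* ↥P').comp φ) '' (W j : Set ↥A) := by
    ext p
    simp only [SetLike.mem_coe, hNW, mem_image, MonoidHom.coe_comp, Function.comp_apply, MonoidHom.coe_coe]
    constructor
    · rintro ⟨w, hw, hwp⟩
      exact ⟨w, hw, Subtype.ext (by rw [hφe, ← hwp])⟩
    · rintro ⟨w, hw, hwp⟩
      exact ⟨w, hw, by rw [← hwp, hφe]⟩
  rw [h]
  -- σ-compact source, Baire Hausdorff target
  haveI : LocallyCompactSpace ↥A := hA.isClosedEmbedding_subtypeVal.locallyCompactSpace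
  haveI : SecondCountableTopology ↥A := hA.isClosedEmbedding_subtypeVal.isEmbedding.secondCountableTopology
  haveI : SigmaCompactSpace ↥A := sigmaCompactSpace_of_locallyCompact_secondCountable
  haveI : LocallyCompactSpace ↥P' := hP'.isClosedEmbedding_subtypeVal.locallyCompactSpace
  haveI : BaireSpace ↥P' := inferInstance
  refine MonoidHom.isOpenMap_of_sigmaCompact ((e : P →* ↥P').comp φ) ?_ ?_ _ (hWo j)
  · intro p
    obtain ⟨w, hw⟩ := hφs (e.symm p)
    exact ⟨w, by rw [MonoidHom.coe_comp, Function.comp_apply, MonoidHom.coe_coe, hw, MulEquiv.apply_symm_apply]⟩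
  · exact he.comp hφc

/-- **`cW j` IS OPEN WHEN IT HAS FINITE INDEX IN `K_W j`** (= ★ FILE 3b's `hcWo` once FILE 3a supplies `[K_W j : cW j] ≠ 0`): `cW j ≤ K_W j` is compact, hence closed,
and of finite index in the open subgroup `K_W j` of `ker φ`, hence open (Mathlib `Subgroup.isOpen_of_isClosed_of_finiteIndex` inside `↥(K_W j)`).
[cite: Serre1979, Ch. VIII §4] [cite: DeitmarEchterhoff2014, §1.5] -/
theorem isOpen_cW_of_relIndex_ne_zero [T2Space G] [T1Space P] (hεA : ∀ x ∈ A, ε x ∈ A) (hεc : Continuous ε) (hφc : Continuous φ)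
    (W : ℕ → Subgroup ↥A) (hWo : ∀ j, IsOpen (W j : Set ↥A)) (hWc : ∀ j, IsCompact (W j : Set ↥A))
    (hWε : ∀ (j : ℕ) (w : ↥A), w ∈ W j → (⟨ε w, hεA w w.2⟩ : ↥A) ∈ W j)
    (KW cW : ℕ → Subgroup ↥φ.ker) (hKW : ∀ (j : ℕ) (k : ↥φ.ker), k ∈ KW j ↔ (k : ↥A) ∈ W j)
    (hcW : ∀ (j : ℕ) (k : ↥φ.ker), k ∈ cW j ↔ ∃ w ∈ W j, (((k : ↥A)) : G) = (w : G) * (ε w)⁻¹)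
    (j : ℕ) (hidx : (cW j).relIndex (KW j) ≠ 0) : IsOpen (cW j : Set ↥φ.ker) := by
  have hle : cW j ≤ KW j := cW_le_KW ε A φ hεA W hWε KW cW hKW hcW j
  have hKWo : IsOpen (KW j : Set ↥φ.ker) := isOpen_KW A φ W hWo KW hKW j
  have hcWcl : IsClosed (cW j : Set ↥φ.ker) := (isCompact_cW ε A φ hεA hεc hφc W hWc cW hcW j).isClosed
  -- inside the open subgroup `K_W j`: the subgroup `cW j ⊓ K_W j` is closed of finite index, hence open
  haveI : ((cW j).subgroupOf (KW j)).FiniteIndex := ⟨hidx⟩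
  have hcl' : IsClosed (((cW j).subgroupOf (KW j) : Subgroup ↥(KW j)) : Set ↥(KW j)) := by
    have h : (((cW j).subgroupOf (KW j) : Subgroup ↥(KW j)) : Set ↥(KW j)) = (Subtype.val : ↥(KW j) → ↥φ.ker) ⁻¹' (cW j : Set ↥φ.ker) := rfl
    rw [h]
    exact hcWcl.preimage continuous_subtype_val
  have hop' : IsOpen (((cW j).subgroupOf (KW j) : Subgroup ↥(KW j)) : Set ↥(KW j)) := Subgroup.isOpen_of_isClosed_of_finiteIndex _ hcl'
  -- push forward along the open embedding `K_W j ↪ ker φ`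
  have himg : (cW j : Set ↥φ.ker) = (Subtype.val : ↥(KW j) → ↥φ.ker) '' (((cW j).subgroupOf (KW j) : Subgroup ↥(KW j)) : Set ↥(KW j)) := by
    ext k
    simp only [SetLike.mem_coe, mem_image, Subgroup.mem_subgroupOf]
    constructor
    · intro hk
      exact ⟨⟨k, hle hk⟩, hk, rfl⟩
    · rintro ⟨k', hk', rfl⟩
      exact hk'
  rw [himg]
  exact hKWo.isOpenEmbedding_subtypeVal.isOpenMap _ hop'

end HerbrandWindowData

end Summit.HodgeConjecture.HodgeConjecture.R90.S4
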